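import Mathlib
import Summits.MatrixMultiplication.MatrixMultiplication.Theses.LevelGradedCohnUmans
import Literature.RepresentationTheory.FiniteGroups.CharacterDegrees
import Literature.Barriers.MatrixMultiplication.NormalizerBarrier

/-!
# Sketch — crux `SubgroupIdentityDesigns` (stmt-MatrixMultiplication-14079), crux-ideate round 1, ideator k = 2

First lemmas of the two crux idea cards

* `rank-spectrum-radial-separators` — RADIAL (rank-metric / Delsarte bilinear-forms) level-`k` tests:
  `g ↦ P(p^{-rk(A(g-h)B)})`, `deg P ≤ k`, lie in `F_k`; hence a subgroup TPP triple whose non-trivial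
  triple products realise at most `k` values of `rk(s - 1)` passes the level-`k` identity test
  (`identityTest_of_sparseSpectrum`), and the transfer `SparseSpectrumDesigns → SubgroupIdentityDesigns`.
* `levi-free-rigid-outer-pieces` — the GRADED NORMALISER INEQUALITY
  `|H₁| · |H₂ ∩ N_G(H₃)| · |H₃| ≤ N_k` (`graded_normalizer_wall`) and its closed pigeonhole form
  `|H₁||H₂||H₃| · |N_G(H₃)| ≤ N_k · |G|` (`graded_normalizer_barrier`), `N_k = #{M : rk M ≤ k} ≥ dim F_k`
  (the Disproof vocabulary of the parent crux LieRankDesigns); it kills the Borel template of card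
  borel-configuration-identity-test and dictates Levi-free outer pieces.

Everything is stated over the crux's own inline clauses (`IsRankTest` is literally the set-builder
predicate of the crux; `IdentityTest` its middle conjunct; `SubgroupTPP` is the tree's).  Statements only
(`sorry`), as allowed at crux-ideate; the transfer's ε-bookkeeping is the parent chain's
`LieRankDesigns_of_levelOneGL2` pattern.
-/

set_option linter.dupNamespace false

noncomputable section

open scoped BigOperators
open Literature.RepresentationTheory.FiniteGroups
open Literature.Barriers.MatrixMultiplication

namespace Summit.MatrixMultiplication.MatrixMultiplication.Cruxes.SubgroupIdentityDesigns.Ideator2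

/-- `GL_m(𝔽_p)` as in the crux. -/
abbrev GLp (m p : ℕ) := Matrix.GeneralLinearGroup (Fin m) (ZMod p)

/-- `M_m(𝔽_p)`. -/
abbrev Mat (m p : ℕ) := Matrix (Fin m) (Fin m) (ZMod p)

/-- The crux's level-`k` test space `F_k` (literally its inline set-builder predicate). -/
def IsRankTest (p m k : ℕ) [Fact p.Prime] (f : GLp m p → ℂ) : Prop :=
  ∃ c : Mat m p → ℂ, (∀ M, k < M.rank → c M = 0) ∧
    ∀ g : GLp m p, f g = ∑ M : Mat m p,
      c M * ZMod.stdAddChar (Matrix.trace (M * (g : Mat m p)))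

/-- The crux's middle conjunct: ONE level-`k` test equal to `δ_1` on `H₁H₂H₃`. -/
def IdentityTest (p m k : ℕ) [Fact p.Prime] (H₁ H₂ H₃ : Subgroup (GLp m p)) : Prop :=
  ∃ f : GLp m p → ℂ, IsRankTest p m k f ∧ f 1 = 1 ∧
    ∀ a ∈ H₁, ∀ b ∈ H₂, ∀ c ∈ H₃, a * b * c ≠ 1 → f (a * b * c) = 0

/-- The crux's graded budget `Σ_{χ ∈ Irr(GL_m(𝔽_p)) ∩ F_k} χ(1)^s`. -/
def gradedBudget (p m k : ℕ) [Fact p.Prime] (s : ℝ) : ℝ :=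
  ∑ᶠ χ ∈ irrChars (GLp m p) ∩ {f | IsRankTest p m k f}, (χ 1).re ^ s

/-- The crux unfolds to `TPP ∧ IdentityTest ∧ budget < V^{(2+ε)/3}` in this vocabulary. -/
theorem crux_iff :
    Summit.MatrixMultiplication.MatrixMultiplication.Theses.LevelGradedCohnUmans.SubgroupIdentityDesigns ↔
      ∀ ε : ℝ, 0 < ε → ∃ (p : ℕ) (_ : Fact p.Prime) (m k : ℕ) (H₁ H₂ H₃ : Subgroup (GLp m p)),
        SubgroupTPP H₁ H₂ H₃ ∧ IdentityTest p m k H₁ H₂ H₃ ∧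
          gradedBudget p m k (2 + ε) <
            ((Nat.card H₁ * Nat.card H₂ * Nat.card H₃ : ℕ) : ℝ) ^ ((2 + ε) / 3) := by
  constructor
  · intro h ε hε
    obtain ⟨p, hp, m, k, H₁, H₂, H₃, hT, ⟨c, hc, h1, h0⟩, hB⟩ := h ε hε
    exact ⟨p, hp, m, k, H₁, H₂, H₃, hT,
      ⟨fun g => ∑ M : Mat m p, c M * ZMod.stdAddChar (Matrix.trace (M * (g : Mat m p))),
        ⟨c, hc, fun g => rfl⟩, h1, h0⟩, hB⟩
  · intro h ε hε
    obtain ⟨p, hp, m, k, H₁, H₂, H₃, hT, ⟨f, ⟨c, hc, hf⟩, h1, h0⟩, hB⟩ := h ε hε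
    refine ⟨p, hp, m, k, H₁, H₂, H₃, hT, ⟨c, hc, ?_, ?_⟩, hB⟩
    · have := hf 1
      rw [this] at h1
      exact h1
    · intro a ha b hb g hg hne
      have := hf (a * b * g)
      rw [← this]
      exact h0 a ha b hb g hg hne

/-! ## Card `levi-free-rigid-outer-pieces`: the graded normaliser inequality -/

/-- **Graded normaliser wall.**  If `(H₁,H₂,H₃)` has the subgroup TPP and passes the level-`k`
identity test with `f`, then the bi-translates `g ↦ f(a⁻¹ g c⁻¹ n⁻¹)` (`a ∈ H₁`, `c ∈ H₃`,
`n ∈ H₂ ∩ N_G(H₃)`, so that `S n⁻¹ = S` for `S = H₁H₂H₃`) are level-`k` functions whose restrictions to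
`S` are the Dirac functions at the pairwise distinct points `a c n`; hence
`|H₁| · |H₂ ∩ N_G(H₃)| · |H₃| ≤ dim F_k ≤ N_k := #{M ∈ M_m(𝔽_p) : rk M ≤ k}`.
Graded analogue of BCGPU 2023 Thm 3.6 (`SubgroupTPP.card_mul_card_normalizer_inf_mul_card_le`, with
`|G|` replaced by the wall).  Kills the Borel template: there `H₂ ≤ {diag(I_k, A)}·T ≤ N_G(H₁)` and,
symmetrically with left translates by `H₂ ∩ N_G(H₁)`, `V ≤ N_k`. -/
theorem graded_normalizer_wall (p m k : ℕ) [Fact p.Prime] (H₁ H₂ H₃ : Subgroup (GLp m p))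
    (hT : SubgroupTPP H₁ H₂ H₃) (hI : IdentityTest p m k H₁ H₂ H₃) :
    Nat.card H₁ * Nat.card ↥(H₂ ⊓ Subgroup.normalizer (H₃ : Set (GLp m p))) * Nat.card H₃ ≤
      Nat.card {M : Mat m p // M.rank ≤ k} := by
  sorry

/-- The same with LEFT translates: `|H₁| · |H₂ ∩ N_G(H₁)| · |H₃| ≤ N_k`. -/
theorem graded_normalizer_wall_left (p m k : ℕ) [Fact p.Prime] (H₁ H₂ H₃ : Subgroup (GLp m p))
    (hT : SubgroupTPP H₁ H₂ H₃) (hI : IdentityTest p m k H₁ H₂ H₃) :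
    Nat.card H₁ * Nat.card ↥(H₂ ⊓ Subgroup.normalizer (H₁ : Set (GLp m p))) * Nat.card H₃ ≤
      Nat.card {M : Mat m p // M.rank ≤ k} := by
  sorry

/-- **Graded normaliser barrier, closed form.**  Pigeonhole `|H₂ ∩ N_G(H₃)| · |G| ≥ |H₂| · |N_G(H₃)|`
turns the wall into `V · |N_G(H₃)| ≤ N_k · |G|`, i.e. `V ≤ N_k · [G : N_G(H₃)]` (and likewise with
`N_G(H₁)`): the OUTER pieces of a witness must have normalisers of index `≥ V/N_k ≈ √W / λ`; a
parabolic-normalised outer piece of type `(1^k, m-k)` caps `V` at the exponent-3 line `W^{3/2}p^{-k/2}`. -/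
theorem graded_normalizer_barrier (p m k : ℕ) [Fact p.Prime] (H₁ H₂ H₃ : Subgroup (GLp m p))
    (hT : SubgroupTPP H₁ H₂ H₃) (hI : IdentityTest p m k H₁ H₂ H₃) :
    Nat.card H₁ * Nat.card H₂ * Nat.card H₃ *
        Nat.card ↥(Subgroup.normalizer (H₃ : Set (GLp m p))) ≤
      Nat.card {M : Mat m p // M.rank ≤ k} * Nat.card (GLp m p) := by
  sorry

/-! ## Card `rank-spectrum-radial-separators`: radial level-`k` tests -/

/-- **Radial lemma (monomial form).**  For `j ≤ k`, `g ↦ p^{-j·rk(g-1)}` is a level-`k` test: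
`p^{j(m - rk(g-1))} = #{E ∈ M_{j×m}(𝔽_p) : E g = E}` is a sum of row-frame juntas `[E g = E]`, each of
Fourier rank `≤ j` (`[Eg = E] = p^{-jm} Σ_C ψ(tr((CE)g)) ψ(-tr(CE))`, `rk(CE) ≤ j`). -/
theorem radialMonomial_isRankTest (p m k j : ℕ) [Fact p.Prime] (hj : j ≤ k) :
    IsRankTest p m k (fun g => ((p : ℂ)⁻¹ ^ ((g : Mat m p) - 1).rank) ^ j) := by
  sorry

/-- **Radial lemma (compressed, polynomial form).**  For `A ∈ M_{a×m}`, `B ∈ M_{m×b}`, a centre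
`h ∈ M_m` and a polynomial `P` of degree `≤ k`, the rank statistic test `g ↦ P(p^{-rk(A(g-h)B)})` lies
in `F_k` (Delsarte's bilinear-forms eigenfunctions, transported by the compression `X ↦ AXB`; the
one-sided cell `[Ag = A]` is the corner `b = m`, `h = 1`, `P = δ_0` on `{0..a}`, `a ≤ k`). -/
theorem compressedRadial_isRankTest (p m k a b : ℕ) [Fact p.Prime]
    (A : Matrix (Fin a) (Fin m) (ZMod p)) (B : Matrix (Fin m) (Fin b) (ZMod p)) (h : Mat m p)
    (P : Polynomial ℂ) (hP : P.natDegree ≤ k) :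
    IsRankTest p m k (fun g => P.eval ((p : ℂ)⁻¹ ^ (A * ((g : Mat m p) - h) * B).rank)) := by
  sorry

/-- **Sparse spectrum ⇒ identity test.**  If the non-trivial triple products `s = abc` realise at most
`k` values of `rk(s - 1)`, all non-zero, then `P(x) = Π_{r ∈ R} (x - p^{-r})/(1 - p^{-r})` gives a
level-`k` test with `P(p^0) = 1` and `P = 0` on `S ∖ 1`. -/
theorem identityTest_of_sparseSpectrum (p m k : ℕ) [Fact p.Prime] (H₁ H₂ H₃ : Subgroup (GLp m p))
    (R : Finset ℕ) (hR : R.card ≤ k) (h0 : 0 ∉ R)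
    (hS : ∀ a ∈ H₁, ∀ b ∈ H₂, ∀ c ∈ H₃, a * b * c ≠ 1 →
      (((a * b * c : GLp m p) : Mat m p) - 1).rank ∈ R) :
    IdentityTest p m k H₁ H₂ H₃ := by
  sorry

/-- **Cell × radial form** (level is additive under products of tests): for a `j`-row-frame
`E ∈ M_{j×m}` and a set `R` of at most `k - j` non-zero ranks, if every non-trivial triple product
either moves `E` or has `rk(s-1) ∈ R`, the level-`k` identity test holds
(`f(g) = [Eg = E] · P_R(p^{-rk(g-1)})`). -/
theorem identityTest_of_cell_mul_radial (p m k j : ℕ) [Fact p.Prime] (hj : j ≤ k)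
    (H₁ H₂ H₃ : Subgroup (GLp m p)) (E : Matrix (Fin j) (Fin m) (ZMod p))
    (R : Finset ℕ) (hR : R.card ≤ k - j) (h0 : 0 ∉ R)
    (hS : ∀ a ∈ H₁, ∀ b ∈ H₂, ∀ c ∈ H₃, a * b * c ≠ 1 →
      E * ((a * b * c : GLp m p) : Mat m p) ≠ E ∨
        (((a * b * c : GLp m p) : Mat m p) - 1).rank ∈ R) :
    IdentityTest p m k H₁ H₂ H₃ := by
  sorry

/-- Transfer target `C⁺` of the radial card: subgroup TPP triples with a `k`-SPARSE RANK SPECTRUM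
beating the level-`k` graded budget. -/
def SparseSpectrumDesigns : Prop :=
  ∀ ε : ℝ, 0 < ε → ∃ (p : ℕ) (_ : Fact p.Prime) (m k : ℕ) (H₁ H₂ H₃ : Subgroup (GLp m p))
    (R : Finset ℕ), SubgroupTPP H₁ H₂ H₃ ∧ R.card ≤ k ∧ 0 ∉ R ∧
      (∀ a ∈ H₁, ∀ b ∈ H₂, ∀ c ∈ H₃, a * b * c ≠ 1 →
        (((a * b * c : GLp m p) : Mat m p) - 1).rank ∈ R) ∧
      gradedBudget p m k (2 + ε) <
        ((Nat.card H₁ * Nat.card H₂ * Nat.card H₃ : ℕ) : ℝ) ^ ((2 + ε) / 3)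

/-- The radial transfer concludes the crux BY NAME (via `identityTest_of_sparseSpectrum` and
`crux_iff`). -/
theorem subgroupIdentityDesigns_of_sparseSpectrum (h : SparseSpectrumDesigns) :
    Summit.MatrixMultiplication.MatrixMultiplication.Theses.LevelGradedCohnUmans.SubgroupIdentityDesigns := by
  rw [crux_iff]
  intro ε hε
  obtain ⟨p, hp, m, k, H₁, H₂, H₃, R, hT, hR, h0, hS, hB⟩ := h ε hε
  exact ⟨p, hp, m, k, H₁, H₂, H₃, hT, identityTest_of_sparseSpectrum p m k H₁ H₂ H₃ R hR h0 hS, hB⟩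

end Summit.MatrixMultiplication.MatrixMultiplication.Cruxes.SubgroupIdentityDesigns.Ideator2
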